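import Literature.Analysis.SpecialFunctions.DigammaVerticalSeries
import Literature.Analysis.ValidatedNumerics.MultiPrecisionInterval
import HarnessLib

/-!
# Format C at `S = {∞, 2}` — closed-form Gram ingredients on the window `[−b, b]` and the (E0) input table

Cell `rh-explicit` (HOME `run/shared/lean/pub/rh-explicit/`), seat cc-s2-4 (`HOME/cc-s2-4/CC4-LEAN.md` §7, §9; LEAD RULING
R7-13: "land the (E0) input-table engine --supports 0098 as the format-C (E) base").  This is file 1/4 of the (E0) base:

* §1 the closed-form ingredients of the `{∞,2}` Gram entries on Yoshida's window basis `χ_n` of `[−b, b]`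
  (`ω_n = πn/b`, `l_k = 2k + ½`, `e_k = e^{−2b l_k}`, the exponential sums `S0, S2, Sdiag, E, E₂`, `Re/Im ψ(¼ + iω_n/2)`,
  `Re ψ′`, the weight `Λ = log 2/√2`, polar / prime-2 / archimedean parts, `gram`, sectors) — Yoshida (5.15)/(5.16) with
  the prime sum restricted to `p = 2` (the tree's `WeilFormatC.semilocalTwoWindowForm_sum_smul_chi` is the entry theorem);
* §2 the kernel INPUT TABLE `EntryInputs` of one sector at scale `S` (boxes of the tree's `NumericsMP.MI`) and its
  validity predicate `EntryInputs.Valid T b` (every box contains its real number) — what an (E0) file proves and what the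
  (E) entry mirror consumes.

Files 2–4 (`S2FormatCE0`, `S2FormatCE0Sound`, `S2FormatCE0Valid`) build the kernel checker that certifies `Valid` for a
literal table generated by the Lean VM.  Honest framing: infrastructure for certifying finite Gram blocks of the `{∞,2}`
semi-local Weil form; nothing here bears on RH by itself.
-/

set_option linter.dupNamespace false
set_option autoImplicit false

noncomputable section

open Complex Set MeasureTheory Filter Finset
open scoped Real Topology ComplexConjugate BigOperators

namespace Summit.RiemannHypothesis.RiemannHypothesis.Theorems.S2FormatC

open Literature.Analysis.SpecialFunctions

/-! ## §1 Closed-form ingredients on the window `[−b, b]` (Yoshida (5.15)/(5.16); `S = {2}`) -/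

/-- `(−1)^k` for an integer `k`. -/
def sgn (k : ℤ) : ℝ := if Even k then 1 else -1

/-- The frequencies `ω_n = πn/b` of the window basis `χ_n(x) = (2b)^{−1/2} e^{iω_n x}·1_{[−b,b]}`. -/
def omega (b : ℝ) (n : ℤ) : ℝ := π * n / b

/-- `s² = (e^{b/2} − e^{−b/2})²` (polar amplitude). -/
def sSq (b : ℝ) : ℝ := (Real.exp (b / 2) - Real.exp (-(b / 2))) ^ 2

/-- `e_k = e^{−2b l_k}`, `l_k = 2k + ½` (`digammaNode k`). -/
def eNode (b : ℝ) (k : ℕ) : ℝ := Real.exp (-(2 * b * digammaNode k))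

/-- `E = Σ_k e_k = e^{−b}/(1 − e^{−4b})`. -/
def eTot (b : ℝ) : ℝ := ∑' k : ℕ, eNode b k

/-- `S0_n = Σ_k e_k/(l_k² + ω_n²)`. -/
def S0 (b : ℝ) (n : ℤ) : ℝ := ∑' k : ℕ, eNode b k / (digammaNode k ^ 2 + omega b n ^ 2)

/-- `S2_n = Σ_k e_k l_k²/(l_k² + ω_n²)`. -/
def S2 (b : ℝ) (n : ℤ) : ℝ := ∑' k : ℕ, eNode b k * digammaNode k ^ 2 / (digammaNode k ^ 2 + omega b n ^ 2)

/-- `Sdiag_n = Σ_k e_k (l_k² − ω_n²)/(l_k² + ω_n²)²`. -/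
def Sdiag (b : ℝ) (n : ℤ) : ℝ :=
  ∑' k : ℕ, eNode b k * (digammaNode k ^ 2 - omega b n ^ 2) / (digammaNode k ^ 2 + omega b n ^ 2) ^ 2

/-- The off-diagonal exponential sum `Σ_k e_k (l_k² − ω_nω_m)/((l_k²+ω_n²)(l_k²+ω_m²))` in partial fractions
(`n ≠ m`; at `m = −n` it is `S0_n`). -/
def expsumOff (b : ℝ) (n m : ℤ) : ℝ :=
  if m = -n then S0 b n
  else ((S2 b n - S2 b m) - omega b n * omega b m * (S0 b n - S0 b m)) / (omega b m ^ 2 - omega b n ^ 2)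

/-- `y_n = Im ψ(¼ + iω_n/2)`. -/
def imPsi (b : ℝ) (n : ℤ) : ℝ := (Complex.digamma (1 / 4 + (omega b n : ℂ) / 2 * I)).im

/-- `Re ψ(¼ + iω_n/2)` (tree: `reDigammaQuarter`). -/
def rePsi (b : ℝ) (n : ℤ) : ℝ := reDigammaQuarter (omega b n)

/-- `Re ψ′(¼ + iω_n/2)`. -/
def rePsi' (b : ℝ) (n : ℤ) : ℝ := (deriv Complex.digamma (1 / 4 + (omega b n : ℂ) / 2 * I)).re

/-- The single prime weight of the `{∞,2}` form on a window `b ≤ log 2`: `Λ = Λ(2)/√2 = log 2/√2`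
(tree: `weilSemilocalCoeff_two_two`). -/
def lam : ℝ := Real.log 2 / Real.sqrt 2

/-- Polar part `(4s²/b)(−1)^{n+m}(1 − 4ω_nω_m)/((1+4ω_n²)(1+4ω_m²))`. -/
def polarG (b : ℝ) (n m : ℤ) : ℝ :=
  sgn (n + m) * (4 * sSq b / b) * (1 - 4 * omega b n * omega b m) /
    ((1 + 4 * omega b n ^ 2) * (1 + 4 * omega b m ^ 2))

/-- Prime-2 part (Yoshida (5.15)/(5.16) with the one length `ℓ = log 2`):
diagonal `−2Λ(1 − log 2/(2b)) cos(ω_n log 2)`, off-diagonal `−Λ(−1)^{n−m}(sin ω_m log 2 − sin ω_n log 2)/(π(n−m))`. -/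
def primeG (b : ℝ) (n m : ℤ) : ℝ :=
  if n = m then -lam * 2 * (1 - Real.log 2 / (2 * b)) * Real.cos (omega b n * Real.log 2)
  else -lam * sgn (n - m) / (π * (n - m)) *
    (Real.sin (omega b m * Real.log 2) - Real.sin (omega b n * Real.log 2))

/-- Archimedean part: diagonal `(−2Sdiag_n + 2b Re ψ + ½ Re ψ′)/(2b)`, off-diagonal
`(−1)^{n+m}(−2·expsumOff + (b/(π(n−m)))(y_n − y_m))/(2b)`. -/
def archG (b : ℝ) (n m : ℤ) : ℝ :=
  if n = m then (-2 * Sdiag b n + 2 * b * rePsi b n + rePsi' b n / 2) / (2 * b)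
  else sgn (n + m) * (-2 * expsumOff b n m + (b / (π * (n - m))) * (imPsi b n - imPsi b m)) / (2 * b)

/-- **The `{∞,2}` Gram entry** `G₂(n,m) = ⟨χ_n, χ_m⟩_{W_{∞,2}} = polar + prime₂ + arch − (log π)δ_{nm}` on `[−b,b]`
(real symmetric). -/
def gram (b : ℝ) (n m : ℤ) : ℝ :=
  polarG b n m + primeG b n m + archG b n m - if n = m then Real.log π else 0

/-- Odd sector `w_n = (χ_n − χ_{−n})/√2`, `n, m ≥ 1`: `W^odd(n,m) = G(n,m) − G(n,−m)`. -/
def gramOdd (b : ℝ) (n m : ℕ) : ℝ := gram b n m - gram b n (-(m : ℤ))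

/-- Even sector `w_0 = χ_0`, `w_n = (χ_n + χ_{−n})/√2`: `W^even(n,m) = G(n,m) + G(n,−m)` (`n,m ≥ 1`),
`W^even(0,m) = √2 G(0,m)`, `W^even(0,0) = G(0,0)`. -/
def gramEven (b : ℝ) (n m : ℕ) : ℝ :=
  if n = 0 ∧ m = 0 then gram b 0 0
  else if n = 0 then Real.sqrt 2 * gram b 0 m
  else if m = 0 then Real.sqrt 2 * gram b n 0
  else gram b n m + gram b n (-(m : ℤ))

/-- Sector selector (`false` = even, `true` = odd). -/
def gramSector (odd : Bool) (b : ℝ) (n m : ℕ) : ℝ := if odd then gramOdd b n m else gramEven b n m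

/-- `E₂ = Σ_k e_k l_k²`. -/
def eTwo (b : ℝ) : ℝ := ∑' k : ℕ, eNode b k * digammaNode k ^ 2

/-! ## §2 The kernel input table of one sector and its validity predicate -/

section EInputs
open Literature.Analysis.ValidatedNumerics.NumericsMP

/-- The kernel input table of one sector at scale `S` (all lists indexed by the mode number `n`). -/
structure EntryInputs where
  /-- fixed-point scale (`u = 1/S`; R5-11's `2^(2C)`) -/
  S : ℕ
  /-- block cut and column cut -/
  M₁ : ℕ
  M₃ : ℕ
  /-- `Re ψ(¼+iω_n/2)`, `n = 0 … M₁+1` (block diagonal + the far cut) -/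
  rePsiBox : List MI
  /-- `Re ψ′(¼+iω_n/2)`, `n = 0 … M₁` -/
  rePsi'Box : List MI
  /-- `Im ψ(¼+iω_n/2)`, `n = 0 … M₃` (block off-diagonal AND every column) -/
  imPsiBox : List MI
  /-- `sin(ω_n log 2)`, `cos(ω_n log 2)`, `n = 0 … M₃` -/
  sinBox : List MI
  cosBox : List MI
  /-- `S0_n`, `S2_n`, `n = 0 … M₃`; `Sdiag_n`, `n = 0 … M₁` -/
  S0Box : List MI
  S2Box : List MI
  SdiagBox : List MI
  /-- scalars: `π`, `log π`, `log 2`, `√2`, `E = Σe_k`, `E₂ = Σe_k l_k²`, `s²` -/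
  piBox : MI
  logPiBox : MI
  logTwoBox : MI
  sqrtTwoBox : MI
  eTotBox : MI
  eTwoBox : MI
  sSqBox : MI
  deriving Repr

/-- **Validity of an input table** (what file (E0) proves, box by box, from the `mem_*` theorems of the tree's
`NumericsMP` engine): every box contains its real number. -/
structure EntryInputs.Valid (T : EntryInputs) (b : ℝ) : Prop where
  hS : 0 < T.S
  rePsi : ∀ n ≤ T.M₁ + 1, MI.mem T.S (S2FormatC.rePsi b n) (T.rePsiBox.getD n default)
  rePsi' : ∀ n ≤ T.M₁, MI.mem T.S (S2FormatC.rePsi' b n) (T.rePsi'Box.getD n default)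
  imPsi : ∀ n ≤ T.M₃, MI.mem T.S (S2FormatC.imPsi b n) (T.imPsiBox.getD n default)
  sin : ∀ n ≤ T.M₃, MI.mem T.S (Real.sin (omega b n * Real.log 2)) (T.sinBox.getD n default)
  cos : ∀ n ≤ T.M₃, MI.mem T.S (Real.cos (omega b n * Real.log 2)) (T.cosBox.getD n default)
  S0 : ∀ n ≤ T.M₃, MI.mem T.S (S2FormatC.S0 b n) (T.S0Box.getD n default)
  S2 : ∀ n ≤ T.M₃, MI.mem T.S (S2FormatC.S2 b n) (T.S2Box.getD n default)
  Sdiag : ∀ n ≤ T.M₁, MI.mem T.S (S2FormatC.Sdiag b n) (T.SdiagBox.getD n default)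
  pi : MI.mem T.S π T.piBox
  logPi : MI.mem T.S (Real.log π) T.logPiBox
  logTwo : MI.mem T.S (Real.log 2) T.logTwoBox
  sqrtTwo : MI.mem T.S (Real.sqrt 2) T.sqrtTwoBox
  eTot : MI.mem T.S (S2FormatC.eTot b) T.eTotBox
  eTwo : MI.mem T.S (S2FormatC.eTwo b) T.eTwoBox
  sSq : MI.mem T.S (S2FormatC.sSq b) T.sSqBox

end EInputs

end Summit.RiemannHypothesis.RiemannHypothesis.Theorems.S2FormatC

end
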